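import Summits.Ventures.HSemireg.WedgeHankelRecurrenceCompleteIntersection
import Summits.Ventures.HSemireg.WedgeHankelRecurrenceWaringDichotomy
import Literature.FieldTheory.FunctionField.PolynomialTwoSimpleZeros
import Mathlib.RingTheory.Polynomial.Wronskian

/-!
# Venture HSemireg — SYLVESTER'S THEOREM ON THE NUMBER OF TERMS (the upper half, and the exact value): over an ALGEBRAICALLY CLOSED field in which `N + 2 − r ≠ 0`, **every class `q` on `[0, N]` of
# middle rank `R^N(q) = r` (`2r ≤ N + 1`) is a sum of `N + 2 − r` geometric sequences with distinct nodes, `q_j = Σ_{i < N+2−r} A_i λ_i^j` (`j ≤ N`)**; `r` terms suffice iff the minimal recurrence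
# is separable of degree `r`; so **the least number of terms is `r` in that case and `N + 2 − r` otherwise** (N61 gave the lower bounds).  The engine is a one-variable BERTINI LEMMA: for coprime
# `f`, `g` with `(deg f : K) ≠ 0`, all but finitely many members `f + a·g` of the pencil have simple roots only (the exceptional `a` are `−f(x)/g(x)`, `x` a root of the Wronskian `f g′ − f′ g`)

HONEST FRAMING. Part of the Lean index of the computation cell `pub-hsemireg` (seat p10 gen 30, Sunday typer «UNIFORM-IN-n»).
LINEAR ALGEBRA OF HANKEL (catalecticant) MATRICES and of polynomials over a field ONLY: no variety, no cohomology theory, no sheaf, no Ext group and no semiregularity map is constructed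
here; nothing here says that HC / HC_CM / HC_AV holds; no Literature FACT (named `Prop`) is declared or used — one PROVED Literature lemma is reused by import
(`Literature.FieldTheory.FunctionField.derivative_ne_zero_of_natDegree_ne_zero`, `(deg f : K) ≠ 0 ⇒ f′ ≠ 0`).  Custodian versions as in `WedgeHankelSiegelIdeal` (1/3); the dictionary («the Waring rank of a
binary form of degree `N` with middle catalecticant rank `r` is `r` if the degree-`r` generator of the apolar ideal is squarefree and `N + 2 − r` otherwise», Sylvester 1851, Comas–Seiguer,
Found. Comput. Math. 11 (2011) Thm. 2) is QUOTED, never asserted — the statements concern sums of geometric sequences `secSeq` agreeing with `q` on `[0, N]`, nodes in `K` (affine chart).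

WHAT IS IN THE TREE.  N56 (`WedgeHankelRecurrenceCompleteIntersection`, № 380): `exists_mem_recSpace_not_mem_map_mulRight` (a second generator `g₀ ∈ Rec_{N+2−r}(q) ∖ m·K[X]_{≤ N+2−2r}`),
`isCoprime_of_not_mem` (`gcd(m, g₀) = 1`), `natDegree_eq_of_not_mem_of_natDegree_lt` (`deg m < r ⇒ deg g₀ = N + 2 − r`); N61 (`WedgeHankelRecurrenceWaringDichotomy`, № 391): `rank_le_of_secSeq_agree`,
`natDegree_eq_and_dvd_of_secSeq_agree`, `separable_of_secSeq_agree`; N23 (№ 176) `exists_secSeq_of_prod_X_sub_C_mem_recSpace` (Prony synthesis); N18 (№ 173) `exists_recSpace_self_eq_span`,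
`natDegree_le_of_mem_recSpace`, `recSpace_mono`, `mul_mem_recSpace_add`, `mem_degreeLT_succ_iff`; N17 (№ 156) `rank_hankel1_half_eq_zero_iff`; Literature (tree, proved):
`Literature.FieldTheory.FunctionField.derivative_ne_zero_of_natDegree_ne_zero` (`PolynomialTwoSimpleZeros`).  Mathlib: `Polynomial.wronskian`, `IsCoprime.wronskian_eq_zero_iff` (`W(f, g) = 0 ⟺
f′ = g′ = 0` for coprime `f`, `g`), `Polynomial.one_lt_rootMultiplicity_iff_isRoot` (a multiple root is a common
root with the derivative), `Polynomial.finite_setOf_isRoot`, `Infinite.exists_notMem_finset`, `IsAlgClosed.splits` / `Polynomial.Splits.eq_prod_roots` / `IsAlgClosed.card_roots_eq_natDegree`,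
`Polynomial.count_roots`, `Multiset.nodup_iff_count_le_one`, `Polynomial.rootMultiplicity_le_one_of_separable`, `Irreducible.coprime_iff_not_dvd`, `IsCoprime.pow_left` / `.mul_left` / `.isUnit_of_dvd'`.
THIS FILE (namespace `Summit.Ventures.HSemireg.Wedge.HankelOuter` continued; PLAIN on N56 + N61 + `Literature.FieldTheory.FunctionField.PolynomialTwoSimpleZeros` (+ `Mathlib.RingTheory.Polynomial.Wronskian`);
0 definitions):
* §607 BERTINI FOR A PENCIL ON THE LINE (any field): `isRoot_wronskian_of_isRoot` (a common root of `f + a·g` and its derivative is a root of `W(f, g)`), `eq_neg_div_of_isRoot` (and `a = −f(x)/g(x)`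
  if `f`, `g` have no common root), `setOf_exists_isRoot_subset`, `finite_setOf_exists_isRoot`, **`exists_forall_not_isRoot_derivative`** (`K` infinite, `W(f, g) ≠ 0`: outside any finite set some
  `a` gives `f + a·g` without multiple roots in `K`); `not_isRoot_and_of_isCoprime`, **`wronskian_ne_zero_of_isCoprime`** (`(deg f : K) ≠ 0`),
  **`exists_forall_rootMultiplicity_le_one`** (coprime pencil ⇒ a member with simple roots only).
* §608 over an ALGEBRAICALLY CLOSED field: `exists_eq_C_mul_prod_X_sub_C_of_rootMultiplicity_le_one` (simple roots + degree `d` ⇒ `c·∏_{i<d} (X − λ_i)`, `λ` injective), `prod_X_sub_C_mem_of_eq_C_mul`.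
* §609 THE LAST WINDOW OF A CLASS: **`exists_isCoprime_mem_recSpace_beyond`** (`R^N(q) = r ≥ 1`, `2r ≤ N + 1`, `K` infinite: coprime `f, g ∈ Rec_{N+2−r}(q)` with `deg g < deg f = N + 2 − r`),
  **`exists_mem_recSpace_beyond_rootMultiplicity_le_one`** (`(N + 2 − r : K) ≠ 0`: a recurrence of exact degree `N + 2 − r` with simple roots only).
* §610 SYLVESTER: **`exists_secSeq_agree_beyond`** (algebraically closed, `(N + 2 − r : K) ≠ 0`: an `(N + 2 − r)`-term representation with distinct nodes ALWAYS exists), `…_of_charZero`;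
  **`exists_secSeq_agree_self_iff`** (`r` terms ⟺ a separable minimal recurrence of degree `r`); the exact value as `IsLeast` of the set of term counts:
  **`isLeast_setOf_exists_secSeq_agree_of_separable`** (`= r`) and **`isLeast_setOf_exists_secSeq_agree_of_not_separable`** (`= N + 2 − r`).
CAVEAT.  The hypothesis `(N + 2 − r : K) ≠ 0` (automatic in characteristic `0`) is what makes the Wronskian of the pencil non-zero; in small positive characteristic the upper half can fail and is
not claimed.  Nodes are taken in `K` (no node at `∞`): the count is the affine one, which for a polar class is where the `N + 2 − r` comes from.  Nothing Ext-side.  New names only.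
-/

open Module Polynomial
open scoped Matrix Polynomial

namespace Summit.Ventures.HSemireg.Wedge.HankelOuter

open Summit.Ventures.HSemireg.Wedge Summit.Ventures.HSemireg.Wedge.Hankel Summit.Ventures.HSemireg.Wedge.HankelSecant

variable (K : Type*) [Field K] {N : ℕ}

/-! ## §607. Bertini for a pencil of polynomials in one variable -/

variable {K}

/-- a common root `x ∈ K` of `f + a·g` and of its derivative is a root of the WRONSKIAN `W(f, g) = f·g′ − f′·g`. -/
theorem isRoot_wronskian_of_isRoot {f g : K[X]} {a x : K} (h0 : (f + C a * g).IsRoot x) (h1 : (derivative (f + C a * g)).IsRoot x) : (wronskian f g).IsRoot x := by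
  rw [IsRoot, eval_add, eval_mul, eval_C] at h0
  rw [derivative_add, derivative_C_mul, IsRoot, eval_add, eval_mul, eval_C] at h1
  rw [IsRoot, wronskian, eval_sub, eval_mul, eval_mul]
  linear_combination (derivative g).eval x * h0 - g.eval x * h1

/-- if `f`, `g` have no common root at `x`, a root `x` of `f + a·g` has `g(x) ≠ 0` and DETERMINES the parameter: `a = −f(x)/g(x)`. -/
theorem eq_neg_div_of_isRoot {f g : K[X]} {a x : K} (hx : ¬ (f.IsRoot x ∧ g.IsRoot x)) (h0 : (f + C a * g).IsRoot x) : g.eval x ≠ 0 ∧ a = -f.eval x / g.eval x := by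
  rw [IsRoot, eval_add, eval_mul, eval_C] at h0
  have hg : g.eval x ≠ 0 := fun hg => hx ⟨by rw [hg, mul_zero, add_zero] at h0; exact h0, hg⟩
  exact ⟨hg, by rw [eq_div_iff hg]; linear_combination h0⟩

/-- **THE EXCEPTIONAL PARAMETERS: if `f`, `g` have no common root in `K`, every `a` for which `f + a·g` has a multiple root in `K` (a common root with its derivative) is `−f(x)/g(x)` for a
root `x ∈ K` of `W(f, g)`.** -/
theorem setOf_exists_isRoot_subset {f g : K[X]} (hfg : ∀ x, ¬ (f.IsRoot x ∧ g.IsRoot x)) :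
    {a : K | ∃ x, (f + C a * g).IsRoot x ∧ (derivative (f + C a * g)).IsRoot x} ⊆ (fun x => -f.eval x / g.eval x) '' {x | (wronskian f g).IsRoot x} := by
  rintro a ⟨x, h0, h1⟩
  exact ⟨x, isRoot_wronskian_of_isRoot h0 h1, (eq_neg_div_of_isRoot (hfg x) h0).2.symm⟩

/-- … hence, for `W(f, g) ≠ 0`, they form a finite set. -/
theorem finite_setOf_exists_isRoot {f g : K[X]} (hW : wronskian f g ≠ 0) (hfg : ∀ x, ¬ (f.IsRoot x ∧ g.IsRoot x)) :
    {a : K | ∃ x, (f + C a * g).IsRoot x ∧ (derivative (f + C a * g)).IsRoot x}.Finite :=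
  ((Polynomial.finite_setOf_isRoot hW).image _).subset (setOf_exists_isRoot_subset hfg)

/-- **BERTINI FOR A PENCIL ON THE LINE: over an INFINITE field, if `W(f, g) ≠ 0` and `f`, `g` have no common root in `K`, then outside any finite set of parameters there is `a ∈ K` such that
`f + a·g` has NO multiple root in `K`.** -/
theorem exists_forall_not_isRoot_derivative [Infinite K] {f g : K[X]} (hW : wronskian f g ≠ 0) (hfg : ∀ x, ¬ (f.IsRoot x ∧ g.IsRoot x)) (S : Finset K) :
    ∃ a ∉ S, ∀ x, ¬ ((f + C a * g).IsRoot x ∧ (derivative (f + C a * g)).IsRoot x) := by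
  classical
  obtain ⟨a, ha⟩ := Infinite.exists_notMem_finset (S ∪ (finite_setOf_exists_isRoot hW hfg).toFinset)
  rw [Finset.mem_union, not_or, Set.Finite.mem_toFinset, Set.mem_setOf_eq, not_exists] at ha
  exact ⟨a, ha.1, ha.2⟩

/-- coprime polynomials have no common root. -/
theorem not_isRoot_and_of_isCoprime {f g : K[X]} (hc : IsCoprime f g) (x : K) : ¬ (f.IsRoot x ∧ g.IsRoot x) := fun ⟨hf, hg⟩ =>
  (Polynomial.irreducible_X_sub_C x).not_isUnit (hc.isUnit_of_dvd' (dvd_iff_isRoot.mpr hf) (dvd_iff_isRoot.mpr hg))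

/-- **the Wronskian of a coprime pair is non-zero as soon as `(deg f : K) ≠ 0`** (in characteristic `0`: `deg f ≥ 1`; Mathlib: for coprime `f`, `g`, `W(f, g) = 0` iff `f′ = g′ = 0`, and
`(deg f : K) ≠ 0 ⇒ f′ ≠ 0` is the tree's `Literature.FieldTheory.FunctionField.derivative_ne_zero_of_natDegree_ne_zero`). -/
theorem wronskian_ne_zero_of_isCoprime {f g : K[X]} (hc : IsCoprime f g) (hf : (f.natDegree : K) ≠ 0) : wronskian f g ≠ 0 := fun h =>
  Literature.FieldTheory.FunctionField.derivative_ne_zero_of_natDegree_ne_zero hf (hc.wronskian_eq_zero_iff.mp h).1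

/-- **A COPRIME PENCIL HAS MEMBERS WITH SIMPLE ROOTS ONLY: `K` infinite, `f`, `g` coprime, `(deg f : K) ≠ 0 ⇒` outside any finite set of parameters there is `a ∈ K` such that every root of
`f + a·g` in `K` is simple.** -/
theorem exists_forall_rootMultiplicity_le_one [Infinite K] {f g : K[X]} (hc : IsCoprime f g) (hf : (f.natDegree : K) ≠ 0) (S : Finset K) :
    ∃ a ∉ S, ∀ x, (f + C a * g).rootMultiplicity x ≤ 1 := by
  obtain ⟨a, haS, ha⟩ := exists_forall_not_isRoot_derivative (wronskian_ne_zero_of_isCoprime hc hf) (not_isRoot_and_of_isCoprime hc) S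
  refine ⟨a, haS, fun x => ?_⟩
  by_cases hp : f + C a * g = 0
  · rw [hp, rootMultiplicity_zero]; exact Nat.zero_le _
  · by_contra hlt
    exact ha x ((one_lt_rootMultiplicity_iff_isRoot hp).mp (by omega))

/-! ## §608. Over an algebraically closed field: simple roots and full degree give `d` distinct linear factors -/

/-- **over an ALGEBRAICALLY CLOSED field a polynomial of degree `d` with simple roots only is `lc · ∏_{i<d} (X − λ_i)` with DISTINCT `λ_i ∈ K`.** -/
theorem exists_eq_C_mul_prod_X_sub_C_of_rootMultiplicity_le_one [IsAlgClosed K] {p : K[X]} {d : ℕ} (hpd : p.natDegree = d) (hmult : ∀ x, p.rootMultiplicity x ≤ 1) :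
    ∃ lam : Fin d → K, Function.Injective lam ∧ p = C p.leadingCoeff * ∏ i, (Polynomial.X - C (lam i)) := by
  classical
  have hnd : p.roots.Nodup := Multiset.nodup_iff_count_le_one.mpr fun x => by rw [count_roots]; exact hmult x
  have hcard : p.roots.toFinset.card = d := by rw [Multiset.toFinset_card_of_nodup hnd, IsAlgClosed.card_roots_eq_natDegree, hpd]
  let e := p.roots.toFinset.equivFin.trans (finCongr hcard)
  refine ⟨fun i => (e.symm i : K), fun i j h => e.symm.injective (Subtype.ext h), ?_⟩
  have hprod : (∏ i : Fin d, (Polynomial.X - C ((e.symm i : K)))) = ∏ x ∈ p.roots.toFinset, (Polynomial.X - C x) := by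
    rw [← Finset.prod_coe_sort p.roots.toFinset]
    exact Fintype.prod_equiv e.symm _ (fun x => Polynomial.X - C (x : K)) fun i => rfl
  rw [hprod, Finset.prod_eq_multiset_prod, Multiset.toFinset_val, Multiset.dedup_eq_self.mpr hnd]
  exact (IsAlgClosed.splits p).eq_prod_roots

/-- if `p = lc(p)·∏ (X − λ_i) ≠ 0` lies in a subspace `W ⊆ K[X]`, so does `∏ (X − λ_i)`. -/
theorem prod_X_sub_C_mem_of_eq_C_mul {p : K[X]} {d : ℕ} {lam : Fin d → K} (hp0 : p ≠ 0) (hprod : p = C p.leadingCoeff * ∏ i, (Polynomial.X - C (lam i))) {W : Submodule K K[X]} (hp : p ∈ W) :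
    (∏ i, (Polynomial.X - C (lam i))) ∈ W := by
  have hlc : p.leadingCoeff ≠ 0 := leadingCoeff_ne_zero.mpr hp0
  have h1 : (∏ i, (Polynomial.X - C (lam i))) = C p.leadingCoeff⁻¹ * p :=
    calc (∏ i, (Polynomial.X - C (lam i))) = C p.leadingCoeff⁻¹ * (C p.leadingCoeff * ∏ i, (Polynomial.X - C (lam i))) := by
          rw [← mul_assoc, ← C_mul, inv_mul_cancel₀ hlc, C_1, one_mul]
      _ = C p.leadingCoeff⁻¹ * p := by rw [← hprod]
  rw [h1, Polynomial.C_mul']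
  exact Submodule.smul_mem _ _ hp

/-! ## §609. The last window of a class contains a recurrence of full degree with simple roots -/

variable (K)

/-- **TWO COPRIME RECURRENCES IN THE LAST WINDOW WITH `deg g < deg f = N + 2 − r`: for `R^N(q) = r ≥ 1`, `2r ≤ N + 1` over an infinite field there are coprime `f, g ∈ Rec_{N+2−r}(q)` with
`deg f = N + 2 − r > deg g`** (from a second generator `g₀` of N56 and the minimal recurrence `m`: if `deg g₀ = N + 2 − r` take `(f, g) = (g₀, m)`; otherwise the class is affine, `deg m = r`,
and `(f, g) = ((X − μ)^{N+2−2r}·m, g₀)` with `g₀(μ) ≠ 0`). -/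
theorem exists_isCoprime_mem_recSpace_beyond [Infinite K] {r : ℕ} {q : ℕ → K} (hq : (hankel1 K N (N / 2) q).rank = r) (hr : 1 ≤ r) (h2 : r + r ≤ N + 1) :
    ∃ f g : K[X], f ∈ recSpace K N q (N + 2 - r) ∧ g ∈ recSpace K N q (N + 2 - r) ∧ IsCoprime f g ∧ f.natDegree = N + 2 - r ∧ g.natDegree < N + 2 - r := by
  obtain ⟨m, hm0, hspan⟩ := exists_recSpace_self_eq_span K hq h2
  have hm : m ∈ recSpace K N q r := by rw [hspan]; exact Submodule.mem_span_singleton_self m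
  obtain ⟨g₀, hg₀, hg₀A⟩ := exists_mem_recSpace_not_mem_map_mulRight K (m := m) hq hr h2 hm0
  have hcop : IsCoprime m g₀ := isCoprime_of_not_mem K hq hr h2 hm hm0 hg₀ hg₀A
  have hmdeg : m.natDegree ≤ r := natDegree_le_of_mem_recSpace K hm
  have hg₀deg : g₀.natDegree ≤ N + 2 - r := natDegree_le_of_mem_recSpace K hg₀
  have hmR : m ∈ recSpace K N q (N + 2 - r) := recSpace_mono K q (by omega) hm
  rcases hg₀deg.eq_or_lt with hdeg | hdeg
  · exact ⟨g₀, m, hg₀, hmR, hcop.symm, hdeg, by omega⟩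
  · -- the class is affine: `deg m = r`
    have hmr : m.natDegree = r := by
      by_contra hne
      exact hdeg.ne (natDegree_eq_of_not_mem_of_natDegree_lt K hq h2 hm hm0 (by omega) hg₀ hg₀A)
    have hg₀0 : g₀ ≠ 0 := by rintro rfl; exact hg₀A (Submodule.zero_mem _)
    classical
    obtain ⟨μ, hμ⟩ := Infinite.exists_notMem_finset g₀.roots.toFinset
    rw [Multiset.mem_toFinset, mem_roots hg₀0] at hμ
    set h : K[X] := (Polynomial.X - C μ) ^ (N + 2 - r - r) with hh
    have hhg : IsCoprime h g₀ := IsCoprime.pow_left (((Polynomial.irreducible_X_sub_C μ).coprime_iff_not_dvd).mpr fun hd => hμ (dvd_iff_isRoot.mp hd))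
    have hhdeg : h.natDegree = N + 2 - r - r := by rw [hh, natDegree_pow, natDegree_X_sub_C, mul_one]
    refine ⟨h * m, g₀, ?_, hg₀, hhg.mul_left hcop, ?_, hdeg⟩
    · have hmem := mul_mem_recSpace_add K (q := q) (k := r) (d := N + 2 - r - r) ((mem_degreeLT_succ_iff K).mpr hhdeg.le) hm
      rwa [show r + (N + 2 - r - r) = N + 2 - r by omega] at hmem
    · rw [natDegree_mul (pow_ne_zero _ (X_sub_C_ne_zero μ)) hm0, hhdeg, hmr]; omega

/-- **A RECURRENCE OF FULL DEGREE WITH SIMPLE ROOTS: `K` infinite, `(N + 2 − r : K) ≠ 0`, `R^N(q) = r ≥ 1`, `2r ≤ N + 1 ⇒` some `p ∈ Rec_{N+2−r}(q)` has exact degree `N + 2 − r` and every root of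
`p` in `K` is simple** (Bertini on the coprime pencil `f + a·g` of the previous theorem). -/
theorem exists_mem_recSpace_beyond_rootMultiplicity_le_one [Infinite K] {r : ℕ} {q : ℕ → K} (hq : (hankel1 K N (N / 2) q).rank = r) (hr : 1 ≤ r) (h2 : r + r ≤ N + 1)
    (hchar : ((N + 2 - r : ℕ) : K) ≠ 0) : ∃ p ∈ recSpace K N q (N + 2 - r), p.natDegree = N + 2 - r ∧ ∀ x, p.rootMultiplicity x ≤ 1 := by
  obtain ⟨f, g, hf, hg, hcop, hfd, hgd⟩ := exists_isCoprime_mem_recSpace_beyond K hq hr h2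
  obtain ⟨a, -, ha⟩ := exists_forall_rootMultiplicity_le_one hcop (by rw [hfd]; exact hchar) ∅
  have hlt : (C a * g).natDegree < f.natDegree := (natDegree_C_mul_le a g).trans_lt (by rw [hfd]; exact hgd)
  refine ⟨f + C a * g, Submodule.add_mem _ hf (by rw [Polynomial.C_mul']; exact Submodule.smul_mem _ a hg), ?_, ha⟩
  rw [natDegree_add_eq_left_of_natDegree_lt hlt, hfd]

/-! ## §610. Sylvester's theorem: `N + 2 − r` terms always suffice; `r` terms iff the minimal recurrence is separable of degree `r` -/

/-- **SYLVESTER'S THEOREM, UPPER HALF: over an ALGEBRAICALLY CLOSED field with `(N + 2 − r : K) ≠ 0`, EVERY class `q` on `[0, N]` of middle rank `R^N(q) = r` (`2r ≤ N + 1`) is a sum of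
`N + 2 − r` geometric sequences with DISTINCT nodes in `K`: `q_j = Σ_{i < N+2−r} A_i λ_i^j` for all `j ≤ N`** (zero weights allowed; for `r = 0` the class is `0` on `[0, N]` and any nodes do). -/
theorem exists_secSeq_agree_beyond [IsAlgClosed K] {r : ℕ} {q : ℕ → K} (hq : (hankel1 K N (N / 2) q).rank = r) (h2 : r + r ≤ N + 1) (hchar : ((N + 2 - r : ℕ) : K) ≠ 0) :
    ∃ (lam A : Fin (N + 2 - r) → K), Function.Injective lam ∧ ∀ j ≤ N, q j = secSeq K A lam j := by
  rcases Nat.eq_zero_or_pos r with rfl | hr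
  · have hq0 := (rank_hankel1_half_eq_zero_iff K (N := N) q).mp hq
    refine ⟨fun i => Infinite.natEmbedding K i, 0, fun i j h => Fin.ext ((Infinite.natEmbedding K).injective h), fun j hj => ?_⟩
    rw [hq0 j hj, secSeq]
    simp only [Pi.zero_apply, zero_mul, Finset.sum_const_zero]
  · obtain ⟨p, hp, hpd, hmult⟩ := exists_mem_recSpace_beyond_rootMultiplicity_le_one K hq hr h2 hchar
    have hp0 : p ≠ 0 := fun h => by rw [h, natDegree_zero] at hpd; omega
    obtain ⟨lam, hlam, hprod⟩ := exists_eq_C_mul_prod_X_sub_C_of_rootMultiplicity_le_one hpd hmult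
    obtain ⟨A, hA⟩ := exists_secSeq_of_prod_X_sub_C_mem_recSpace K hlam (prod_X_sub_C_mem_of_eq_C_mul hp0 hprod hp)
    exact ⟨lam, A, hlam, hA⟩

/-- … in particular over an algebraically closed field of CHARACTERISTIC `0`, with no further hypothesis. -/
theorem exists_secSeq_agree_beyond_of_charZero [IsAlgClosed K] [CharZero K] {r : ℕ} {q : ℕ → K} (hq : (hankel1 K N (N / 2) q).rank = r) (h2 : r + r ≤ N + 1) :
    ∃ (lam A : Fin (N + 2 - r) → K), Function.Injective lam ∧ ∀ j ≤ N, q j = secSeq K A lam j :=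
  exists_secSeq_agree_beyond K hq h2 (Nat.cast_ne_zero.mpr (by omega))

/-- **`r` TERMS SUFFICE IFF THE MINIMAL RECURRENCE IS SEPARABLE OF DEGREE `r`** (algebraically closed `K`; `R^N(q) = r`, `2r ≤ N + 1`): `q_j = Σ_{i<r} A_i λ_i^j` on `[0, N]` with distinct
`λ_i ∈ K` iff some `0 ≠ m ∈ Rec_r(q)` has `deg m = r` and is separable (forward: N61; backward: split `m` into distinct linear factors and synthesise, N23). -/
theorem exists_secSeq_agree_self_iff [IsAlgClosed K] {r : ℕ} {q : ℕ → K} (hq : (hankel1 K N (N / 2) q).rank = r) (h2 : r + r ≤ N + 1) :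
    (∃ (lam A : Fin r → K), Function.Injective lam ∧ ∀ j ≤ N, q j = secSeq K A lam j) ↔ ∃ m ∈ recSpace K N q r, m ≠ 0 ∧ m.natDegree = r ∧ m.Separable := by
  constructor
  · rintro ⟨lam, A, hlam, hrep⟩
    obtain ⟨m, hm0, hspan⟩ := exists_recSpace_self_eq_span K hq h2
    have hm : m ∈ recSpace K N q r := by rw [hspan]; exact Submodule.mem_span_singleton_self m
    exact ⟨m, hm, hm0, (natDegree_eq_and_dvd_of_secSeq_agree K hq hm hm0 hlam h2 hrep).1, separable_of_secSeq_agree K hq hm hm0 hlam h2 hrep⟩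
  · rintro ⟨m, hm, hm0, hmr, hsep⟩
    obtain ⟨lam, hlam, hprod⟩ := exists_eq_C_mul_prod_X_sub_C_of_rootMultiplicity_le_one hmr (rootMultiplicity_le_one_of_separable hsep)
    obtain ⟨A, hA⟩ := exists_secSeq_of_prod_X_sub_C_mem_recSpace K hlam (prod_X_sub_C_mem_of_eq_C_mul hm0 hprod hm)
    exact ⟨lam, A, hlam, hA⟩

/-- **SYLVESTER'S THEOREM, THE EXACT NUMBER OF TERMS (a): if the minimal recurrence is separable of degree `r`, the least `t` admitting a representation `q_j = Σ_{i<t} A_i λ_i^j` (`j ≤ N`,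
distinct nodes in `K`) is `t = r`** (algebraically closed `K`; `R^N(q) = r`, `2r ≤ N + 1`; every representation has `t ≥ R^N(q)`, N61). -/
theorem isLeast_setOf_exists_secSeq_agree_of_separable [IsAlgClosed K] {r : ℕ} {q : ℕ → K} (hq : (hankel1 K N (N / 2) q).rank = r) (h2 : r + r ≤ N + 1)
    (hsep : ∃ m ∈ recSpace K N q r, m ≠ 0 ∧ m.natDegree = r ∧ m.Separable) :
    IsLeast {t : ℕ | ∃ (lam A : Fin t → K), Function.Injective lam ∧ ∀ j ≤ N, q j = secSeq K A lam j} r :=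
  ⟨(exists_secSeq_agree_self_iff K hq h2).mpr hsep, fun _ ⟨_, _, hlam, hrep⟩ => hq ▸ rank_le_of_secSeq_agree K hlam hrep⟩

/-- **SYLVESTER'S THEOREM, THE EXACT NUMBER OF TERMS (b): otherwise — a polar class, or a minimal recurrence of degree `r` with a repeated root — the least number of terms is `N + 2 − r`**
(algebraically closed `K` with `(N + 2 − r : K) ≠ 0`; `R^N(q) = r`, `2r ≤ N + 1`; a shorter representation, `t + r ≤ N + 1`, would force a separable minimal recurrence of degree `r`, N61). -/
theorem isLeast_setOf_exists_secSeq_agree_of_not_separable [IsAlgClosed K] {r : ℕ} {q : ℕ → K} (hq : (hankel1 K N (N / 2) q).rank = r) (h2 : r + r ≤ N + 1)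
    (hchar : ((N + 2 - r : ℕ) : K) ≠ 0) (hno : ¬ ∃ m ∈ recSpace K N q r, m ≠ 0 ∧ m.natDegree = r ∧ m.Separable) :
    IsLeast {t : ℕ | ∃ (lam A : Fin t → K), Function.Injective lam ∧ ∀ j ≤ N, q j = secSeq K A lam j} (N + 2 - r) := by
  refine ⟨exists_secSeq_agree_beyond K hq h2 hchar, fun t ht => ?_⟩
  obtain ⟨lam, A, hlam, hrep⟩ := ht
  by_contra hlt
  obtain ⟨m, hm0, hspan⟩ := exists_recSpace_self_eq_span K hq h2
  have hm : m ∈ recSpace K N q r := by rw [hspan]; exact Submodule.mem_span_singleton_self m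
  have ht : t + r ≤ N + 1 := by simp only [not_le] at hlt; omega
  exact hno ⟨m, hm, hm0, (natDegree_eq_and_dvd_of_secSeq_agree K hq hm hm0 hlam ht hrep).1, separable_of_secSeq_agree K hq hm hm0 hlam ht hrep⟩

end Summit.Ventures.HSemireg.Wedge.HankelOuter
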